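import Mathlib
import Literature.Probability.Process.PointStationaryTransfer
import Literature.Probability.Process.RootedHardCoreConfig

/-!
# Rooted isometry classes of a point set: deterministic algebra

Helper file A of stub `stub_finiteOrbitsOfChargedClass` (line `Sketch`, crux `AtomicLawChargesCrystal`,
stmt-AtomisticToContinuum-15778; the Palm lever "a charged rooted isometry class has finitely many
symmetry orbits").

For a point set `D ⊆ ℝ³`, a linear isometry `A` and a root `q`, the ROOTED COPY of `D` is the counting
measure `count|((fun s => A (s - q)) '' D)`; the CLASS EVENT of the root `q` is
`{μ | ∃ A, μ = count|((fun s => A (s - q)) '' D)}`.  This file records the deterministic facts the Mecke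
computation consumes:

* `fo_count_restrict_eq_iff` — counting measures determine their carriers;
* `fo_image_eq_of_sym` / `fo_exists_sym_of_image_eq` — two rooted copies `A(D − q)`, `A'(D − q')` coincide
  iff `q' = g q` for a symmetry `g` of `D` (`g '' D = D`); hence class events of equivalent roots are
  equal and class events of inequivalent roots are disjoint (`fo_classEvent_eq_of_sym`,
  `fo_sym_of_mem_classEvent_inter`);
* `fo_map_sub_rootedCopy` — re-rooting the copy `A(D − q)` at its point `A(s − q)` gives `A(D − s)`;
* `fo_rootedCopy_finite_inter` — rooted copies of a separated set are locally finite.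
-/

noncomputable section

namespace Summit.AtomisticToContinuum.Crystallization.Theorems.IsometryAtomsAtomicLawChargesCrystal

open MeasureTheory Metric Set

/-! ## Counting measures determine their carriers -/

/-- Two counting measures `count|S`, `count|S'` on `ℝ³` are equal iff `S = S'` (test on singletons).
[folklore] -/
theorem fo_count_restrict_eq_iff (S S' : Set (EuclideanSpace ℝ (Fin 3))) :
    (Measure.count : Measure (EuclideanSpace ℝ (Fin 3))).restrict S = (Measure.count : Measure (EuclideanSpace ℝ (Fin 3))).restrict S' ↔ S = S' := by
  refine ⟨fun h => ?_, fun h => by rw [h]⟩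
  ext y
  rw [← Literature.Probability.Process.count_restrict_singleton_ne_zero_iff S y, h,
    Literature.Probability.Process.count_restrict_singleton_ne_zero_iff]

/-! ## Rooted copies and symmetries -/

/-- If `g` is a symmetry of `D` (`g '' D = D`) then the rooted copy of `D` at the root `g q` through `A`
is the rooted copy at the root `q` through `A ∘ g.linear`:
`A (D − g q) = (A ∘ L)(D − q)` with `L` the linear part of `g`. [folklore] -/
theorem fo_image_eq_of_sym (D : Set (EuclideanSpace ℝ (Fin 3))) (g : (EuclideanSpace ℝ (Fin 3)) ≃ᵃⁱ[ℝ] (EuclideanSpace ℝ (Fin 3))) (hg : g '' D = D)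
    (A : (EuclideanSpace ℝ (Fin 3)) →ₗᵢ[ℝ] (EuclideanSpace ℝ (Fin 3))) (q : (EuclideanSpace ℝ (Fin 3))) :
    (fun s => A (s - g q)) '' D =
      (fun s => (A.comp g.linearIsometryEquiv.toLinearIsometry) (s - q)) '' D := by
  ext y
  simp only [mem_image, LinearIsometry.coe_comp, Function.comp_apply,
    LinearIsometryEquiv.coe_toLinearIsometry]
  constructor
  · rintro ⟨s, hs, rfl⟩
    -- `s = g t` with `t ∈ D`
    have hs' : s ∈ g '' D := by rw [hg]; exact hs
    obtain ⟨t, ht, rfl⟩ := hs'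
    refine ⟨t, ht, ?_⟩
    rw [← vsub_eq_sub (g t) (g q), ← g.map_vsub, vsub_eq_sub]
  · rintro ⟨t, ht, rfl⟩
    refine ⟨g t, ?_, ?_⟩
    · have : g t ∈ g '' D := ⟨t, ht, rfl⟩
      rwa [hg] at this
    · rw [← vsub_eq_sub (g t) (g q), ← g.map_vsub, vsub_eq_sub]

/-- The symmetry built from two representations of the same rooted copy: if
`A (D − q) = A' (D − q')` as images, then `x ↦ L (x − q) + q'` with `L = A'⁻¹ ∘ A` is an affine
isometry mapping `D` onto `D` and `q` to `q'`. [folklore] -/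
theorem fo_exists_sym_of_image_eq (D : Set (EuclideanSpace ℝ (Fin 3))) (A A' : (EuclideanSpace ℝ (Fin 3)) →ₗᵢ[ℝ] (EuclideanSpace ℝ (Fin 3))) (q q' : (EuclideanSpace ℝ (Fin 3)))
    (h : (fun s => A (s - q)) '' D = (fun s => A' (s - q')) '' D) :
    ∃ g : (EuclideanSpace ℝ (Fin 3)) ≃ᵃⁱ[ℝ] (EuclideanSpace ℝ (Fin 3)), g '' D = D ∧ g q = q' := by
  -- upgrade the linear isometries to equivalences (finite dimension)
  set Ae : (EuclideanSpace ℝ (Fin 3)) ≃ₗᵢ[ℝ] (EuclideanSpace ℝ (Fin 3)) := A.toLinearIsometryEquiv rfl with hAe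
  set Ae' : (EuclideanSpace ℝ (Fin 3)) ≃ₗᵢ[ℝ] (EuclideanSpace ℝ (Fin 3)) := A'.toLinearIsometryEquiv rfl with hAe'
  have hA : ∀ x, A x = Ae x := fun x => by rw [hAe, LinearIsometry.toLinearIsometryEquiv_apply]
  have hA' : ∀ x, A' x = Ae' x := fun x => by rw [hAe', LinearIsometry.toLinearIsometryEquiv_apply]
  set L : (EuclideanSpace ℝ (Fin 3)) ≃ₗᵢ[ℝ] (EuclideanSpace ℝ (Fin 3)) := Ae.trans Ae'.symm with hL
  have hL' : ∀ x, L x = Ae'.symm (Ae x) := fun x => rfl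
  -- the affine map
  let e : (EuclideanSpace ℝ (Fin 3)) → (EuclideanSpace ℝ (Fin 3)) := fun x => L (x - q) + q'
  have he : ∀ p' : (EuclideanSpace ℝ (Fin 3)), e p' = L (p' -ᵥ q) +ᵥ e q := by
    intro p'
    simp only [e, vsub_eq_sub, vadd_eq_add, sub_self, map_zero, zero_add]
  refine ⟨AffineIsometryEquiv.mk' e L q he, ?_, ?_⟩
  · rw [AffineIsometryEquiv.coe_mk']
    -- pointwise description of membership through the two representations
    have key : ∀ s : (EuclideanSpace ℝ (Fin 3)), s ∈ D ↔ L (s - q) + q' ∈ D := by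
      intro s
      constructor
      · intro hs
        have h1 : A (s - q) ∈ (fun s => A' (s - q')) '' D := by
          rw [← h]; exact ⟨s, hs, rfl⟩
        obtain ⟨t, ht, hts⟩ := h1
        have hts : A' (t - q') = A (s - q) := hts
        have : L (s - q) = t - q' := by
          rw [hL', ← hA, ← hts, hA', LinearIsometryEquiv.symm_apply_apply]
        rw [this, sub_add_cancel]
        exact ht
      · intro hs
        have h1 : A' (L (s - q) + q' - q') ∈ (fun s => A (s - q)) '' D := by
          rw [h]; exact ⟨_, hs, rfl⟩
        obtain ⟨t, ht, hts⟩ := h1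
        have hts : A (t - q) = A' (L (s - q) + q' - q') := hts
        rw [add_sub_cancel_right, hA', hL', LinearIsometryEquiv.apply_symm_apply, ← hA] at hts
        have := A.injective hts
        have hst : t = s := by
          have := sub_left_injective this
          exact this
        rw [← hst]; exact ht
    ext y
    simp only [mem_image]
    constructor
    · rintro ⟨s, hs, rfl⟩
      exact (key s).1 hs
    · intro hy
      refine ⟨L.symm (y - q') + q, ?_, ?_⟩
      · rw [key]
        simpa using hy
      · simp [e]
  · rw [AffineIsometryEquiv.coe_mk']
    simp [e]

/-- **Class events of equivalent roots coincide**: if `g '' D = D` then every rooted copy at the root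
`g q` is a rooted copy at the root `q` and conversely. [folklore] -/
theorem fo_classEvent_eq_of_sym (D : Set (EuclideanSpace ℝ (Fin 3))) (g : (EuclideanSpace ℝ (Fin 3)) ≃ᵃⁱ[ℝ] (EuclideanSpace ℝ (Fin 3))) (hg : g '' D = D) (q : (EuclideanSpace ℝ (Fin 3))) :
    {μ : Measure (EuclideanSpace ℝ (Fin 3)) | ∃ A : (EuclideanSpace ℝ (Fin 3)) →ₗᵢ[ℝ] (EuclideanSpace ℝ (Fin 3)),
        μ = (Measure.count : Measure (EuclideanSpace ℝ (Fin 3))).restrict ((fun s => A (s - g q)) '' D)} =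
      {μ : Measure (EuclideanSpace ℝ (Fin 3)) | ∃ A : (EuclideanSpace ℝ (Fin 3)) →ₗᵢ[ℝ] (EuclideanSpace ℝ (Fin 3)),
        μ = (Measure.count : Measure (EuclideanSpace ℝ (Fin 3))).restrict ((fun s => A (s - q)) '' D)} := by
  ext μ
  simp only [mem_setOf_eq]
  constructor
  · rintro ⟨A, rfl⟩
    exact ⟨_, by rw [fo_image_eq_of_sym D g hg A q]⟩
  · rintro ⟨A, rfl⟩
    -- use the inverse symmetry: `q = g⁻¹ (g q)`
    have hg' : g.symm '' D = D := by
      rw [← hg, Set.image_image]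
      simp [hg]
    refine ⟨A.comp g.symm.linearIsometryEquiv.toLinearIsometry, ?_⟩
    have := fo_image_eq_of_sym D g.symm hg' A (g q)
    rw [AffineIsometryEquiv.symm_apply_apply] at this
    rw [this]

/-- **Class events of inequivalent roots are disjoint**: a configuration lying in the class events of
the roots `q` and `q'` witnesses a symmetry of `D` carrying `q` to `q'`. [folklore] -/
theorem fo_sym_of_mem_classEvent_inter (D : Set (EuclideanSpace ℝ (Fin 3))) (q q' : (EuclideanSpace ℝ (Fin 3))) (μ : Measure (EuclideanSpace ℝ (Fin 3)))
    (hq : μ ∈ {μ : Measure (EuclideanSpace ℝ (Fin 3)) | ∃ A : (EuclideanSpace ℝ (Fin 3)) →ₗᵢ[ℝ] (EuclideanSpace ℝ (Fin 3)),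
        μ = (Measure.count : Measure (EuclideanSpace ℝ (Fin 3))).restrict ((fun s => A (s - q)) '' D)})
    (hq' : μ ∈ {μ : Measure (EuclideanSpace ℝ (Fin 3)) | ∃ A : (EuclideanSpace ℝ (Fin 3)) →ₗᵢ[ℝ] (EuclideanSpace ℝ (Fin 3)),
        μ = (Measure.count : Measure (EuclideanSpace ℝ (Fin 3))).restrict ((fun s => A (s - q')) '' D)}) :
    ∃ g : (EuclideanSpace ℝ (Fin 3)) ≃ᵃⁱ[ℝ] (EuclideanSpace ℝ (Fin 3)), g '' D = D ∧ g q = q' := by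
  obtain ⟨A, rfl⟩ := hq
  obtain ⟨A', hA'⟩ := hq'
  exact fo_exists_sym_of_image_eq D A A' q q' ((fo_count_restrict_eq_iff _ _).1 hA')

/-! ## Re-rooting a rooted copy -/

/-- The points of the rooted copy `A (D − q)`: `y` is a point iff `y = A (s − q)` with `s ∈ D`.
[folklore] -/
theorem fo_rootedCopy_singleton_ne_zero_iff (D : Set (EuclideanSpace ℝ (Fin 3))) (A : (EuclideanSpace ℝ (Fin 3)) →ₗᵢ[ℝ] (EuclideanSpace ℝ (Fin 3))) (q y : (EuclideanSpace ℝ (Fin 3))) :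
    (Measure.count : Measure (EuclideanSpace ℝ (Fin 3))).restrict ((fun s => A (s - q)) '' D) {y} ≠ 0 ↔
      ∃ s ∈ D, A (s - q) = y := by
  rw [Literature.Probability.Process.count_restrict_singleton_ne_zero_iff, mem_image]

/-- **Re-rooting a rooted copy at one of its points**: `θ_{A(s−q)} (count|A(D − q)) = count|A(D − s)`.
[folklore] -/
theorem fo_map_sub_rootedCopy (D : Set (EuclideanSpace ℝ (Fin 3))) (A : (EuclideanSpace ℝ (Fin 3)) →ₗᵢ[ℝ] (EuclideanSpace ℝ (Fin 3))) (q s : (EuclideanSpace ℝ (Fin 3))) :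
    ((Measure.count : Measure (EuclideanSpace ℝ (Fin 3))).restrict ((fun t => A (t - q)) '' D)).map
        (fun z => z - A (s - q)) =
      (Measure.count : Measure (EuclideanSpace ℝ (Fin 3))).restrict ((fun t => A (t - s)) '' D) := by
  rw [Literature.Probability.Process.map_sub_count_restrict, Set.image_image]
  congr 1
  ext y
  simp only [mem_image]
  constructor
  · rintro ⟨t, ht, rfl⟩
    exact ⟨t, ht, by rw [← map_sub, sub_sub_sub_cancel_right]⟩
  · rintro ⟨t, ht, rfl⟩
    exact ⟨t, ht, by rw [← map_sub, sub_sub_sub_cancel_right]⟩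

/-! ## Local finiteness of rooted copies of separated sets -/

/-- A rooted copy of a `ρ`-separated set is `ρ`-separated. [folklore] -/
theorem fo_rootedCopy_separated {D : Set (EuclideanSpace ℝ (Fin 3))} {ρ : ℝ}
    (hD : ∀ x ∈ D, ∀ y ∈ D, x ≠ y → ρ ≤ dist x y) (A : (EuclideanSpace ℝ (Fin 3)) →ₗᵢ[ℝ] (EuclideanSpace ℝ (Fin 3))) (q : (EuclideanSpace ℝ (Fin 3))) :
    ∀ x ∈ (fun s => A (s - q)) '' D, ∀ y ∈ (fun s => A (s - q)) '' D, x ≠ y → ρ ≤ dist x y := by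
  rintro _ ⟨s, hs, rfl⟩ _ ⟨t, ht, rfl⟩ hne
  have hst : s ≠ t := fun h => hne (by rw [h])
  have := hD s hs t ht hst
  rwa [A.dist_map, dist_sub_right]

/-- A rooted copy of a `ρ`-separated set (`ρ > 0`) meets every compact set in a finite set. [folklore] -/
theorem fo_rootedCopy_finite_inter {D : Set (EuclideanSpace ℝ (Fin 3))} {ρ : ℝ} (hρ : 0 < ρ)
    (hD : ∀ x ∈ D, ∀ y ∈ D, x ≠ y → ρ ≤ dist x y) (A : (EuclideanSpace ℝ (Fin 3)) →ₗᵢ[ℝ] (EuclideanSpace ℝ (Fin 3))) (q : (EuclideanSpace ℝ (Fin 3)))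
    {K : Set (EuclideanSpace ℝ (Fin 3))} (hK : IsCompact K) :
    (K ∩ (fun s => A (s - q)) '' D).Finite :=
  Literature.Probability.Process.LocalConfig.finite_inter_of_separated hρ
    (fo_rootedCopy_separated hD A q) hK

/-- A rooted copy of a `ρ`-separated set (`ρ > 0`) gives finite mass to every norm shell
`{z | ⌊‖z‖⌋₊ = n}` (the local-finiteness hypothesis of the kernel device
`Literature.Probability.Process.exists_isSFiniteKernel_apply_eq_self`). [folklore] -/
theorem fo_rootedCopy_shell_lt_top {D : Set (EuclideanSpace ℝ (Fin 3))} {ρ : ℝ} (hρ : 0 < ρ)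
    (hD : ∀ x ∈ D, ∀ y ∈ D, x ≠ y → ρ ≤ dist x y) (A : (EuclideanSpace ℝ (Fin 3)) →ₗᵢ[ℝ] (EuclideanSpace ℝ (Fin 3))) (q : (EuclideanSpace ℝ (Fin 3))) (n : ℕ) :
    (Measure.count : Measure (EuclideanSpace ℝ (Fin 3))).restrict ((fun s => A (s - q)) '' D)
        ((fun z : (EuclideanSpace ℝ (Fin 3)) => ⌊‖z‖⌋₊) ⁻¹' {n}) < ⊤ := by
  rw [Measure.restrict_apply (Literature.Probability.Process.measurableSet_floorNorm_preimage n)]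
  have hfin : ((fun z : (EuclideanSpace ℝ (Fin 3)) => ⌊‖z‖⌋₊) ⁻¹' {n} ∩ (fun s => A (s - q)) '' D).Finite := by
    refine ((fo_rootedCopy_finite_inter hρ hD A q
      (isCompact_closedBall (0 : (EuclideanSpace ℝ (Fin 3))) ((n : ℝ) + 1))).subset ?_)
    exact Set.inter_subset_inter_left _
      (Literature.Probability.Process.floorNorm_preimage_subset_closedBall n)
  rw [Measure.count_apply_finite _ hfin]
  exact ENNReal.natCast_lt_top _

/-- A `ρ`-separated set (`ρ > 0`) written as a counting measure gives finite mass to every norm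
shell. [folklore] -/
theorem fo_count_restrict_shell_lt_top {S : Set (EuclideanSpace ℝ (Fin 3))} {ρ : ℝ} (hρ : 0 < ρ)
    (hS : ∀ x ∈ S, ∀ y ∈ S, x ≠ y → ρ ≤ dist x y) (n : ℕ) :
    (Measure.count : Measure (EuclideanSpace ℝ (Fin 3))).restrict S ((fun z : (EuclideanSpace ℝ (Fin 3)) => ⌊‖z‖⌋₊) ⁻¹' {n}) < ⊤ := by
  rw [Measure.restrict_apply (Literature.Probability.Process.measurableSet_floorNorm_preimage n)]
  have hfin : ((fun z : (EuclideanSpace ℝ (Fin 3)) => ⌊‖z‖⌋₊) ⁻¹' {n} ∩ S).Finite := by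
    refine ((Literature.Probability.Process.LocalConfig.finite_inter_of_separated hρ hS
      (isCompact_closedBall (0 : (EuclideanSpace ℝ (Fin 3))) ((n : ℝ) + 1))).subset ?_)
    exact Set.inter_subset_inter_left _
      (Literature.Probability.Process.floorNorm_preimage_subset_closedBall n)
  rw [Measure.count_apply_finite _ hfin]
  exact ENNReal.natCast_lt_top _

/-- A `ρ`-separated subset of `ℝ³` (`ρ > 0`) is countable (it meets each ball `closedBall 0 n`
in a finite set). [folklore] -/
theorem fo_countable_of_separated {S : Set (EuclideanSpace ℝ (Fin 3))} {ρ : ℝ} (hρ : 0 < ρ)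
    (hS : ∀ x ∈ S, ∀ y ∈ S, x ≠ y → ρ ≤ dist x y) : S.Countable := by
  have : S = ⋃ n : ℕ, (closedBall (0 : (EuclideanSpace ℝ (Fin 3))) n ∩ S) := by
    ext x
    simp only [mem_iUnion, mem_inter_iff, mem_closedBall, dist_zero_right]
    exact ⟨fun hx => ⟨⌈‖x‖⌉₊, Nat.le_ceil _, hx⟩, fun ⟨_, _, hx⟩ => hx⟩
  rw [this]
  exact countable_iUnion fun n =>
    (Literature.Probability.Process.LocalConfig.finite_inter_of_separated hρ hS
      (isCompact_closedBall _ _)).countable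

/-- **Registered sub-goal A of stub `stub_finiteOrbitsOfChargedClass`** (binder-free packaging of
`fo_exists_sym_of_image_eq` for the ledger's stub registry): two representations of one rooted copy
differ by a symmetry of `D`. [folklore] -/
theorem fo_subgoalA_symOfImageEq : ∀ (D : Set (EuclideanSpace ℝ (Fin 3))) (A A' : EuclideanSpace ℝ (Fin 3) →ₗᵢ[ℝ] EuclideanSpace ℝ (Fin 3)) (q q' : EuclideanSpace ℝ (Fin 3)), (fun s => A (s - q)) '' D = (fun s => A' (s - q')) '' D → ∃ g : EuclideanSpace ℝ (Fin 3) ≃ᵃⁱ[ℝ] EuclideanSpace ℝ (Fin 3), g '' D = D ∧ g q = q' :=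
  fun D A A' q q' h => fo_exists_sym_of_image_eq D A A' q q' h

end Summit.AtomisticToContinuum.Crystallization.Theorems.IsometryAtomsAtomicLawChargesCrystal

end
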